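import Summits.QuantumFields.YangMills.Theorems.UnitScaleTiltProp7Lane2CutoffCommutators
import HarnessLib

/-!
# Route `UnitScaleTilt`, crux «MinimiserStabilityRegPr» (stmt-QuantumFields-19200), E′ ∕ (N06) LANE II «DIVERGENCE RECOVERY AT CURVED `W`» — brick (B6), LOCALITY OF THE TWO COMMUTATORS:
# `D_W(ζλ) − ζ(·₋)D_Wλ` reads `λ` ONLY at the targets of bonds along which `ζ` changes, and `[Δ_W, ζ]λ` reads `λ` ONLY on the 1-neighbourhood of the sites where `ζ` is not locally
# constant — so both commutators are UNCHANGED when `λ` is replaced by `θ•λ` (any `θ ≡ 1` there, e.g. px9's plateau cutoff `ζ̃`) or by `λ` restricted to that set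

Cell `ym3-torus`, width seat `ym3-torus-px11` (gen 6); ★p1 g19 RECIPE-hPatch (09:1xZ) «Two traps (px4's (Z) warning) and their cures: (R2) and h11 are applied … to `φ′_c := Z̃s_c φ_c` …
LHS unchanged; (R1) is applied to `φ″_c := 𝟙_{A_c}·φ_c` … the commutator is UNCHANGED».  These are the two «LHS unchanged» identities, by name.  THEOREMS ONLY (0 `def`, 0 `sorry`);
`--supports stmt-QuantumFields-19200`, count-neutral.  YM₃ on T³ is a ladder rung (R3), not the Clay problem; nothing here claims (B7), (REC), `hN06`, a stub, the crux, d = 4 or the gap.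
* §1 ★★ `gradComm_congr` — if `λ′(b₊) = λ(b₊)` for every bond with `ζ(b₊) ≠ ζ(b₋)`, the gradient commutators of `λ′` and `λ` coincide (✓`DL2_smul_sub_smul_eq_toL2`);
  `gradComm_smul_eq` (`λ′ = θ•λ`, `θ = 1` on those targets); `gradComm_ite_eq` (`λ′ = 𝟙_A·λ`, `A ∋` those targets).
* §2 ★★ `lapComm_congr` — if `λ′ = λ` at `x` and at `x ± e_μ` for every `x` where `ζ` is not locally constant, the Laplacian commutators coincide (✓`covLapSite_comm_apply`,
  ✓`covLapSite_comm_apply_eq_zero`, ✓`divB_covD_smul_fun`); `lapComm_smul_eq`; `lapComm_ite_eq`.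
HONEST: pointwise bookkeeping; nothing of (B7)∕(REC)∕hN06∕the crux is proved or claimed.

References: T. Bałaban, CMP 99 (1985) 389–434 [Balaban1985BackgroundPropagators] ((3.3) p.391, (3.23) p.394, (3.100) pp.413–414); CMP 96 (1984) 223–250 [Balaban1984PropagatorsII] (p.238).
-/

set_option autoImplicit false

noncomputable section

open scoped BigOperators Matrix.Norms.L2Operator Matrix

namespace Summit.QuantumFields.YangMills.Theorems.Prop7Lane2CommutatorLocality

open Literature.MathematicalPhysics.QuantumFieldTheory.Balaban1983to89
open Literature.MathematicalPhysics.QuantumFieldTheory.Balaban1983to89.T3ContinuumYM3Torus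
open T3SectALandauChart (bgUnits eta)
open B9Eq39Adjoint (R covD covDstar divB)
open B9TorusCalculus (torusT torusT_apply torusT_symm_apply)
open B11Eq103H1Complex (SiteL2K BondL2K)
open Summit.QuantumFields.YangMills.Theorems.Prop7SectET3Transport (periodsT3)
open Summit.QuantumFields.YangMills.Theorems.Prop7SectET3HilbertLetters (W₂ toL2 toL2S DL2 covLapSite)
open Summit.QuantumFields.YangMills.Theorems.Prop7ConjFrameTransport (divB_covD_smul_fun)
open Summit.QuantumFields.YangMills.Theorems.Prop7Lane2CutoffCommutators (DL2_smul_sub_smul_eq_toL2 covLapSite_comm_apply covLapSite_comm_apply_eq_zero)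

variable (F : T3Family) (n K : ℕ) (c₀ : ℝ) [Fact (0 < c₀)] (W : GaugeField (F.P K) 0 (Matrix.specialUnitaryGroup (Fin 2) ℂ)) (ζ : Site (F.P K) 0 → ℝ)

/-! ## §1 ★★ The gradient commutator reads `λ` only at the targets of the bonds along which `ζ` changes -/

/-- ★★ **LOCALITY OF `D_W(ζλ) − ζ(·₋)D_Wλ`**: if `λ′(b₊) = λ(b₊)` whenever `ζ(b₊) ≠ ζ(b₋)`, the two gradient commutators are EQUAL.
[cite: Balaban1985BackgroundPropagators, (3.3) p.391, (3.100) pp.413–414] -/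
theorem gradComm_congr (l l' : Site (F.P K) 0 → Matrix (Fin 2) (Fin 2) ℂ) (h : ∀ b : PBond (F.P K) 0, ζ b.tgt ≠ ζ b.src → l' b.tgt = l b.tgt) :
    DL2 F n K c₀ W (toL2S F K c₀ (fun x => ζ x • l' x)) - toL2 F K c₀ (fun b => ζ b.src • (toL2 F K c₀).symm (DL2 F n K c₀ W (toL2S F K c₀ l')) b)
      = DL2 F n K c₀ W (toL2S F K c₀ (fun x => ζ x • l x)) - toL2 F K c₀ (fun b => ζ b.src • (toL2 F K c₀).symm (DL2 F n K c₀ W (toL2S F K c₀ l)) b) := by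
  rw [DL2_smul_sub_smul_eq_toL2 F n K c₀ W ζ l, DL2_smul_sub_smul_eq_toL2 F n K c₀ W ζ l']
  congr 1
  funext b
  by_cases hb : ζ b.tgt = ζ b.src
  · rw [hb, sub_self, mul_zero, zero_smul, zero_smul]
  · rw [h b hb]

/-- With a second cutoff: if `θ = 1` at every target `b₊` with `ζ(b₊) ≠ ζ(b₋)`, the gradient commutator of `θ•λ` is that of `λ` (RECIPE «h11 on `ζ̃φ`: LHS unchanged»).
[cite: Balaban1985BackgroundPropagators, (3.100) pp.413–414; Balaban1984PropagatorsII, p.238] -/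
theorem gradComm_smul_eq (θ : Site (F.P K) 0 → ℝ) (l : Site (F.P K) 0 → Matrix (Fin 2) (Fin 2) ℂ) (h : ∀ b : PBond (F.P K) 0, ζ b.tgt ≠ ζ b.src → θ b.tgt = 1) :
    DL2 F n K c₀ W (toL2S F K c₀ (fun x => ζ x • (θ x • l x))) - toL2 F K c₀ (fun b => ζ b.src • (toL2 F K c₀).symm (DL2 F n K c₀ W (toL2S F K c₀ (fun x => θ x • l x))) b)
      = DL2 F n K c₀ W (toL2S F K c₀ (fun x => ζ x • l x)) - toL2 F K c₀ (fun b => ζ b.src • (toL2 F K c₀).symm (DL2 F n K c₀ W (toL2S F K c₀ l)) b) :=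
  gradComm_congr F n K c₀ W ζ l (fun x => θ x • l x) fun b hb => by
    show θ b.tgt • l b.tgt = l b.tgt
    rw [h b hb, one_smul]

/-- With an indicator: if the decidable predicate `p` holds at every target `b₊` with `ζ(b₊) ≠ ζ(b₋)`, the gradient commutator of `𝟙_p·λ` is that of `λ` (RECIPE «(R1) on `𝟙_A φ`:
the commutator is UNCHANGED»). [cite: Balaban1985BackgroundPropagators, (3.100) pp.413–414; Balaban1984PropagatorsII, p.238] -/
theorem gradComm_ite_eq (p : Site (F.P K) 0 → Prop) [DecidablePred p] (l : Site (F.P K) 0 → Matrix (Fin 2) (Fin 2) ℂ)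
    (h : ∀ b : PBond (F.P K) 0, ζ b.tgt ≠ ζ b.src → p b.tgt) :
    DL2 F n K c₀ W (toL2S F K c₀ (fun x => ζ x • (if p x then l x else 0)))
        - toL2 F K c₀ (fun b => ζ b.src • (toL2 F K c₀).symm (DL2 F n K c₀ W (toL2S F K c₀ (fun x => if p x then l x else 0))) b)
      = DL2 F n K c₀ W (toL2S F K c₀ (fun x => ζ x • l x)) - toL2 F K c₀ (fun b => ζ b.src • (toL2 F K c₀).symm (DL2 F n K c₀ W (toL2S F K c₀ l)) b) :=
  gradComm_congr F n K c₀ W ζ l (fun x => if p x then l x else 0) fun b hb => by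
    show (if p b.tgt then l b.tgt else 0) = l b.tgt
    rw [if_pos (h b hb)]

/-! ## §2 ★★ The Laplacian commutator reads `λ` only on the 1-neighbourhood of the sites where `ζ` is not locally constant -/

/-- ★★ **LOCALITY OF `[Δ_W, ζ]`**: if, at every site `x` where `ζ` is NOT locally constant (some `ζ(x ± e_μ) ≠ ζ(x)`), `λ′` agrees with `λ` at `x` and at all `x ± e_μ`, the two Laplacian
commutators are EQUAL. [cite: Balaban1985BackgroundPropagators, (3.23) p.394, (3.100) pp.413–414; Balaban1984PropagatorsII, p.238] -/
theorem lapComm_congr (l l' : Site (F.P K) 0 → Matrix (Fin 2) (Fin 2) ℂ)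
    (h : ∀ x : Site (F.P K) 0, (¬ ∀ μ : Fin 3, ζ (x.shift μ) = ζ x ∧ ζ (x.unshift μ) = ζ x) →
      l' x = l x ∧ ∀ μ : Fin 3, l' (x.shift μ) = l (x.shift μ) ∧ l' (x.unshift μ) = l (x.unshift μ)) :
    covLapSite F n K c₀ W (toL2S F K c₀ (fun z => ζ z • l' z)) - toL2S F K c₀ (fun x => ζ x • (toL2S F K c₀).symm (covLapSite F n K c₀ W (toL2S F K c₀ l')) x)
      = covLapSite F n K c₀ W (toL2S F K c₀ (fun z => ζ z • l z)) - toL2S F K c₀ (fun x => ζ x • (toL2S F K c₀).symm (covLapSite F n K c₀ W (toL2S F K c₀ l)) x) := by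
  apply (toL2S F K c₀).symm.injective
  funext x
  simp only [map_sub, LinearEquiv.symm_apply_apply, Pi.sub_apply]
  by_cases hx : ∀ μ : Fin 3, ζ (x.shift μ) = ζ x ∧ ζ (x.unshift μ) = ζ x
  · rw [covLapSite_comm_apply_eq_zero F n K c₀ W ζ l' x hx, covLapSite_comm_apply_eq_zero F n K c₀ W ζ l x hx]
  · obtain ⟨h0, hμ⟩ := h x hx
    rw [covLapSite_comm_apply, covLapSite_comm_apply, divB_covD_smul_fun, divB_covD_smul_fun, add_sub_cancel_left, add_sub_cancel_left]
    congr 1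
    refine Finset.sum_congr rfl fun μ _ => ?_
    simp only [covD, covDstar, torusT_apply, torusT_symm_apply, h0, (hμ μ).1, (hμ μ).2]

/-- With a second cutoff `θ = 1` on the 1-neighbourhood of the sites where `ζ` is not locally constant: `[Δ_W, ζ](θ•λ) = [Δ_W, ζ]λ` (RECIPE «(R2) on `ζ̃φ`: LHS unchanged»).
[cite: Balaban1985BackgroundPropagators, (3.100) pp.413–414; Balaban1984PropagatorsII, p.238] -/
theorem lapComm_smul_eq (θ : Site (F.P K) 0 → ℝ) (l : Site (F.P K) 0 → Matrix (Fin 2) (Fin 2) ℂ)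
    (h : ∀ x : Site (F.P K) 0, (¬ ∀ μ : Fin 3, ζ (x.shift μ) = ζ x ∧ ζ (x.unshift μ) = ζ x) →
      θ x = 1 ∧ ∀ μ : Fin 3, θ (x.shift μ) = 1 ∧ θ (x.unshift μ) = 1) :
    covLapSite F n K c₀ W (toL2S F K c₀ (fun z => ζ z • (θ z • l z)))
        - toL2S F K c₀ (fun x => ζ x • (toL2S F K c₀).symm (covLapSite F n K c₀ W (toL2S F K c₀ (fun z => θ z • l z))) x)
      = covLapSite F n K c₀ W (toL2S F K c₀ (fun z => ζ z • l z)) - toL2S F K c₀ (fun x => ζ x • (toL2S F K c₀).symm (covLapSite F n K c₀ W (toL2S F K c₀ l)) x) :=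
  lapComm_congr F n K c₀ W ζ l (fun z => θ z • l z) fun x hx => by
    obtain ⟨h0, hμ⟩ := h x hx
    refine ⟨?_, fun μ => ⟨?_, ?_⟩⟩
    · show θ x • l x = l x
      rw [h0, one_smul]
    · show θ (x.shift μ) • l (x.shift μ) = l (x.shift μ)
      rw [(hμ μ).1, one_smul]
    · show θ (x.unshift μ) • l (x.unshift μ) = l (x.unshift μ)
      rw [(hμ μ).2, one_smul]

/-- With an indicator of a decidable predicate `p` holding on the 1-neighbourhood of the sites where `ζ` is not locally constant: `[Δ_W, ζ](𝟙_p·λ) = [Δ_W, ζ]λ`.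
[cite: Balaban1985BackgroundPropagators, (3.100) pp.413–414; Balaban1984PropagatorsII, p.238] -/
theorem lapComm_ite_eq (p : Site (F.P K) 0 → Prop) [DecidablePred p] (l : Site (F.P K) 0 → Matrix (Fin 2) (Fin 2) ℂ)
    (h : ∀ x : Site (F.P K) 0, (¬ ∀ μ : Fin 3, ζ (x.shift μ) = ζ x ∧ ζ (x.unshift μ) = ζ x) →
      p x ∧ ∀ μ : Fin 3, p (x.shift μ) ∧ p (x.unshift μ)) :
    covLapSite F n K c₀ W (toL2S F K c₀ (fun z => ζ z • (if p z then l z else 0)))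
        - toL2S F K c₀ (fun x => ζ x • (toL2S F K c₀).symm (covLapSite F n K c₀ W (toL2S F K c₀ (fun z => if p z then l z else 0))) x)
      = covLapSite F n K c₀ W (toL2S F K c₀ (fun z => ζ z • l z)) - toL2S F K c₀ (fun x => ζ x • (toL2S F K c₀).symm (covLapSite F n K c₀ W (toL2S F K c₀ l)) x) :=
  lapComm_congr F n K c₀ W ζ l (fun z => if p z then l z else 0) fun x hx => by
    obtain ⟨h0, hμ⟩ := h x hx
    refine ⟨?_, fun μ => ⟨?_, ?_⟩⟩
    · show (if p x then l x else 0) = l x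
      rw [if_pos h0]
    · show (if p (x.shift μ) then l (x.shift μ) else 0) = l (x.shift μ)
      rw [if_pos (hμ μ).1]
    · show (if p (x.unshift μ) then l (x.unshift μ) else 0) = l (x.unshift μ)
      rw [if_pos (hμ μ).2]

end Summit.QuantumFields.YangMills.Theorems.Prop7Lane2CommutatorLocality

end
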